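import Summits.CriticalPhenomena.CardyFormulaZ2.Theorems.CardyFlipRussoVoronoiHubFromSmirnovDefs

/-!
# Stub `exists_finset_net_closedBall` of line `moebius-exact-delaunay-dilation-ward`
# (crux `VoronoiHubFromSmirnov`, stmt-CriticalPhenomena-6433)

Explicit finite nets of a planar disc (the counting input of the "no giant cells" localisation,
I. Benjamini, O. Schramm, *Conformal invariance of Voronoi percolation*, Comm. Math. Phys. 197
(1998) 75–107, Lemma 5.5, where it is combined with the void-ball union bound
`poisson_voidBall_unionBound`): every `A ⊆ closedBall 0 ρ` is covered by the open `r`-balls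
(`0 < r ≤ ρ`) centred at a finite set `X ⊆ ℂ` with `|X| ≤ (4ρ/r + 1)²`.

Proof (square grid). Put `N := ⌈ρ/r⌉₊` and let `X` be the image of the grid patch
`{-N, …, N}² ⊆ ℤ²` under `(m, n) ↦ (m r) + (n r) i`.
* Cardinality: `|X| ≤ (2N+1)²` (`Finset.card_image_le`, `Finset.card_product`, `Int.card_Icc`)
  and `2N + 1 < 2ρ/r + 3 ≤ 4ρ/r + 1` (`Nat.ceil_lt_add_one`, `1 ≤ ρ/r`).
* Covering: for `a ∈ A` round `a.re / r`, `a.im / r` to the nearest integers `m`, `n`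
  (`abs_sub_round`); then `|a.re - m r|, |a.im - n r| ≤ r/2`, so
  `‖a - (m r + n r i)‖² ≤ r²/4 + r²/4 < r²`; and `|m|, |n| ≤ N` because
  `|a.re|, |a.im| ≤ ‖a‖ ≤ ρ ≤ N r` and `m`, `n`, `N` are integers.

No new definitions; Mathlib only.
-/

noncomputable section

namespace Summit.CriticalPhenomena.CardyFormulaZ2.Cruxes.VoronoiHubFromSmirnov.MoebiusExactDelaunayDilationWard

/-- Rounding a real number of modulus `≤ N` (`N : ℕ`) to the nearest integer lands in `[-N, N]`:
`|round x| ≤ |x| + 1/2 < N + 1`, and both sides are integers. -/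
theorem gn_abs_round_le {x : ℝ} {N : ℕ} (hx : |x| ≤ N) : |round x| ≤ (N : ℤ) := by
  have h1 : |x - round x| ≤ 1 / 2 := abs_sub_round x
  have h2 : |((round x : ℤ) : ℝ)| < N + 1 := by
    have h3 := abs_sub_abs_le_abs_sub ((round x : ℤ) : ℝ) x
    rw [abs_sub_comm] at h3
    linarith
  rw [← Int.lt_add_one_iff]
  exact_mod_cast h2

/-- Rounding `a.re / r` and `a.im / r` (`r > 0`) to the nearest integers `m`, `n` produces the
point `m r + n r i` of the grid `r ℤ²` at distance `< r` from `a`: each coordinate is off by at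
most `r/2`, so the squared distance is at most `r²/4 + r²/4 = r²/2 < r²`. -/
theorem gn_norm_sub_round_lt (a : ℂ) {r : ℝ} (hr : 0 < r) :
    ‖a - ⟨((round (a.re / r) : ℤ) : ℝ) * r, ((round (a.im / r) : ℤ) : ℝ) * r⟩‖ < r := by
  have h1 : |a.re / r - round (a.re / r)| ≤ 1 / 2 := abs_sub_round _
  have h2 : |a.im / r - round (a.im / r)| ≤ 1 / 2 := abs_sub_round _
  have h1' : |a.re - round (a.re / r) * r| ≤ r / 2 := by
    have e : a.re - round (a.re / r) * r = (a.re / r - round (a.re / r)) * r := by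
      rw [sub_mul, div_mul_cancel₀ _ hr.ne']
    rw [e, abs_mul, abs_of_pos hr]
    nlinarith
  have h2' : |a.im - round (a.im / r) * r| ≤ r / 2 := by
    have e : a.im - round (a.im / r) * r = (a.im / r - round (a.im / r)) * r := by
      rw [sub_mul, div_mul_cancel₀ _ hr.ne']
    rw [e, abs_mul, abs_of_pos hr]
    nlinarith
  have hsq : ‖a - ⟨((round (a.re / r) : ℤ) : ℝ) * r, ((round (a.im / r) : ℤ) : ℝ) * r⟩‖ ^ 2
      < r ^ 2 := by
    rw [Complex.sq_norm, Complex.normSq_apply, Complex.sub_re, Complex.sub_im]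
    have e1 : (a.re - round (a.re / r) * r) ^ 2 ≤ (r / 2) ^ 2 := by
      rw [← sq_abs (a.re - round (a.re / r) * r)]
      exact pow_le_pow_left₀ (abs_nonneg _) h1' 2
    have e2 : (a.im - round (a.im / r) * r) ^ 2 ≤ (r / 2) ^ 2 := by
      rw [← sq_abs (a.im - round (a.im / r) * r)]
      exact pow_le_pow_left₀ (abs_nonneg _) h2' 2
    nlinarith
  exact lt_of_pow_lt_pow_left₀ 2 hr.le hsq

/-- The square grid patch `{-N, …, N}²` (`N : ℕ`) has `(2N+1)²` points, hence so does, at most,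
its image under any map. -/
theorem gn_card_image_grid_le {β : Type*} [DecidableEq β] (N : ℕ) (f : ℤ × ℤ → β) :
    ((((Finset.Icc (-(N : ℤ)) N) ×ˢ (Finset.Icc (-(N : ℤ)) N)).image f).card : ℝ)
      ≤ (2 * N + 1) ^ 2 := by
  have hc : ((Finset.Icc (-(N : ℤ)) N).card : ℝ) = 2 * N + 1 := by
    rw [Int.card_Icc]
    have e : ((N : ℤ) + 1 - -(N : ℤ)).toNat = 2 * N + 1 := by omega
    rw [e]
    push_cast
    ring
  calc ((((Finset.Icc (-(N : ℤ)) N) ×ˢ (Finset.Icc (-(N : ℤ)) N)).image f).card : ℝ)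
      ≤ (((Finset.Icc (-(N : ℤ)) N) ×ˢ (Finset.Icc (-(N : ℤ)) N)).card : ℝ) := by
        exact_mod_cast Finset.card_image_le
    _ = (2 * N + 1) ^ 2 := by
        rw [Finset.card_product, Nat.cast_mul, hc]
        ring

/-- The mesh count: with `N = ⌈ρ/r⌉₊` and `0 < r ≤ ρ` one has `2N + 1 ≤ 4ρ/r + 1`
(`N < ρ/r + 1` and `1 ≤ ρ/r`). -/
theorem gn_two_mul_ceil_add_one_le {r ρ : ℝ} (hr : 0 < r) (hrρ : r ≤ ρ) :
    2 * (⌈ρ / r⌉₊ : ℝ) + 1 ≤ 4 * ρ / r + 1 := by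
  have h0 : 1 ≤ ρ / r := by rwa [le_div_iff₀ hr, one_mul]
  have h1 : (⌈ρ / r⌉₊ : ℝ) < ρ / r + 1 := Nat.ceil_lt_add_one (by linarith)
  have h2 : 4 * ρ / r = 4 * (ρ / r) := by ring
  linarith

/-- **Explicit grid nets of a disc.** For `0 < r ≤ ρ`, every `A ⊆ closedBall (0 : ℂ) ρ` is
covered by the open balls of radius `r` centred at the points of a finite set `X` with
`|X| ≤ (4ρ/r + 1)²` — namely the grid points `m r + n r i`, `|m|, |n| ≤ ⌈ρ/r⌉₊`
(the counting input of Benjamini–Schramm 1998, Lemma 5.5). -/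
theorem exists_finset_net_closedBall : ∀ (A : Set ℂ) (r ρ : ℝ), 0 < r → r ≤ ρ → A ⊆ Metric.closedBall 0 ρ → ∃ X : Finset ℂ, (X.card : ℝ) ≤ (4 * ρ / r + 1) ^ 2 ∧ A ⊆ ⋃ x ∈ X, Metric.ball x r := by
  intro A r ρ hr hrρ hA
  set N : ℕ := ⌈ρ / r⌉₊ with hN
  refine ⟨((Finset.Icc (-(N : ℤ)) N) ×ˢ (Finset.Icc (-(N : ℤ)) N)).image
    (fun mn : ℤ × ℤ => (⟨((mn.1 : ℤ) : ℝ) * r, ((mn.2 : ℤ) : ℝ) * r⟩ : ℂ)), ?_, ?_⟩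
  · calc _ ≤ (2 * (N : ℝ) + 1) ^ 2 := gn_card_image_grid_le N _
      _ ≤ (4 * ρ / r + 1) ^ 2 :=
        pow_le_pow_left₀ (by positivity) (gn_two_mul_ceil_add_one_le hr hrρ) 2
  · intro a ha
    have ha' : ‖a‖ ≤ ρ := by
      have h := hA ha
      rwa [Metric.mem_closedBall, dist_zero_right] at h
    have hρr : ρ / r ≤ N := Nat.le_ceil _
    have hre : |a.re / r| ≤ N := by
      rw [abs_div, abs_of_pos hr]
      exact (div_le_div_of_nonneg_right ((Complex.abs_re_le_norm a).trans ha') hr.le).trans hρr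
    have him : |a.im / r| ≤ N := by
      rw [abs_div, abs_of_pos hr]
      exact (div_le_div_of_nonneg_right ((Complex.abs_im_le_norm a).trans ha') hr.le).trans hρr
    rw [Set.mem_iUnion₂]
    refine ⟨⟨((round (a.re / r) : ℤ) : ℝ) * r, ((round (a.im / r) : ℤ) : ℝ) * r⟩, ?_, ?_⟩
    · rw [Finset.mem_image]
      refine ⟨(round (a.re / r), round (a.im / r)), ?_, rfl⟩
      rw [Finset.mem_product, Finset.mem_Icc, Finset.mem_Icc]
      exact ⟨abs_le.mp (gn_abs_round_le hre), abs_le.mp (gn_abs_round_le him)⟩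
    · rw [Metric.mem_ball, dist_eq_norm]
      exact gn_norm_sub_round_lt a hr

end Summit.CriticalPhenomena.CardyFormulaZ2.Cruxes.VoronoiHubFromSmirnov.MoebiusExactDelaunayDilationWard
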